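import Summits.QuantumFields.BalabanUV.Beta.FP.ReGaugedShotDeterminant

/-!
# `BalabanUV.Beta.FP.ReGaugedShotDeterminantUpdate` — road «FP» for binder row D1, row H″-DECOMP (model), THE UPDATE-SIGN TWINS
# of the owner's `FP/ReGaugedShotDeterminant` (a positive weight `EᵀE` ADDED to the fine form — R-FP-17's `R_n^{g}` step, an inner
# gauge-fixing weight `τᵀτ`): `det kkt (H + EᵀE) Q = det kkt H Q · det (1 + E·flucCov H Q·Eᵀ)`, the three-factor form, the `logZ` forms,
# and the TWO-STAGE `logZ` bookkeeping (downdate∘downdate, update∘downdate)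

HONEST DEPENDENCY (page 1, mandatory): continuum YM on T⁴ ⇐ BetaPertH ∧ nine spine estimates (0/9 proved); BetaPertH ⇐ (D1) ∧ (D4) ∧
CAP+tail; G-an2-4 gates asym, D1 and NE2/3/4.  HONEST FRAMING (cell contract, verbatim): «discharging `BetaPertH` makes Bałaban's UV
stability UNCONDITIONAL — a real constructive-QFT result; it is NOT the continuum limit and NOT the Clay problem.»  THIS MODULE is [folklore]
finite-dimensional linear algebra over a field (Mathlib's matrix determinant lemma `Matrix.det_add_mul`, b12's `Composition.det_kkt'` ∕ `logZ`,
leaf-05-g8's `FP/ConstrainedWoodbury` lift identities and the owner's `FP/ReGaugedShotDeterminant`, all BY NAME); model level; no `def`, no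
`def … : Prop`, nothing cited, 0 sorry; 0 estimates; 0∕4 binders of row D1; NOT D1, NOT BetaPertH, NOT continuum, NOT Clay.

ABSOLUTE RULE (cell charter, verbatim): «No internally-minted statement may enter as a cited fact. Every hypothesis is either kernel-proved in
this package or a verbatim quotation of a PUBLISHED theorem with page reference. The manuscript(s) under audit are NOT citable for their own
disputed steps — they are the thing under adjudication; programme-internal (2001/route/tribunal) claims are never citable.»

CONTENT (every hypothesis an invertibility; `𝕜` any field in §1–§3, `ℝ` in §4–§5).
* §1 `det_update`: `det (K + UᵀU) = det K · det (1 + U K⁻¹ Uᵀ)` (`Matrix.det_add_mul`).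
* §2 `kkt_update_eq` (`kkt (H + EᵀE) Q = kkt H Q + ÛᵀÛ`, `Û := fromCols E 0`), **`det_kkt_update`**: `det kkt (H + EᵀE) Q = det kkt H Q · det (1 + E·flucCov H Q·Eᵀ)`
  under `IsUnit (kkt H Q).det` ONLY, `isUnit_det_kkt_update_iff`.
* §3 invertible `H`: **`det_kkt_update_three`** `= (−1)^{|μ|} · (det H · det (QH⁻¹Qᵀ)) · det (1 + E·flucCov H Q·Eᵀ)`, `abs_det_kkt_update_three`.
* §4 `logZ_update` (`logZ (H + EᵀE) Q = logZ H Q − ½·log|det(1 + EΓ₀Eᵀ)|`), **`logZ_update_three`** (the three-term form).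
* §5 TWO STAGES (R-FP-17 (H′2): constraint-type deficit `E₁`, then ghost-type deficit `E₂`; the covariance side is g8's `flucCov_downdate_twice`):
  `logZ_downdate_twice` (`logZ (H − E₁ᵀE₁ − E₂ᵀE₂) Q = logZ H Q − ½log|det M₁| − ½log|det M₂|`, `M₁ = 1 − E₁Γ₀E₁ᵀ`, `M₂ = 1 − E₂Γ₁E₂ᵀ`,
  `Γ₁ = flucCov (H − E₁ᵀE₁) Q`) and the mixed `logZ_update_downdate` (a weight added, then a deficit removed).
Provenance: D1 formalisation swarm, unit b2b-balaban-beta-d1-formalise-leaf-05 gen 9 (prover-b2b-balaban-beta-d1-formalise-leaf-05-g9-0),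
2026-08-20; the owner's «STOP leaf-05 … YOURS (GO): the UPDATE-sign twins» (journal 2026-08-20T20:15Z).  [folklore], 0 def, 0 cite, 0 sorry.
-/

namespace Summit.QuantumFields.BalabanUV.Beta.FP.ReGaugedShotDeterminantUpdate

open scoped Matrix
open Matrix
open Literature.MathematicalPhysics.QuantumFieldTheory.Balaban1983to89.Beta.Composition (kkt blockProp det_kkt' logZ)
open Literature.MathematicalPhysics.QuantumFieldTheory.Balaban1983to89.Beta.CompositionSingular (flucCov kkt_eq_fromBlocks)
open Summit.QuantumFields.BalabanUV.Beta.FP.ConstrainedWoodbury (lift_mul_kktInv_mul_lift_transpose isUnit_det_kkt_downdate flucCov_update)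
open Summit.QuantumFields.BalabanUV.Beta.FP.ReGaugedShotDeterminant (det_kkt_downdate logZ_downdate)

variable {𝕜 : Type*} [Field 𝕜]
variable {ι κ ν μ : Type*} [Fintype ι] [Fintype κ] [Fintype ν] [Fintype μ] [DecidableEq ι] [DecidableEq κ] [DecidableEq ν] [DecidableEq μ]

/-! ## §1 The determinant of a rank-`κ` update -/

/-- [folklore] **MATRIX DETERMINANT LEMMA, UPDATE FORM**: for invertible `K`, `det (K + UᵀU) = det K · det (1 + U K⁻¹ Uᵀ)`
(Mathlib `Matrix.det_add_mul` at `(Uᵀ, U)`). -/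
theorem det_update (K : Matrix ι ι 𝕜) (U : Matrix κ ι 𝕜) (hK : IsUnit K.det) :
    (K + Uᵀ * U).det = K.det * (1 + U * K⁻¹ * Uᵀ).det :=
  Matrix.det_add_mul Uᵀ U hK

/-! ## §2 Through the border: no invertibility of `H` -/

omit [Fintype ν] [Fintype μ] [DecidableEq κ] [DecidableEq ν] [DecidableEq μ] in
/-- [folklore] The bordered matrix of the UPDATED form is the update of the bordered matrix by the lift `Û := fromCols E 0`:
`kkt (H + EᵀE) Q = kkt H Q + ÛᵀÛ` (twin of g8's `ConstrainedWoodbury.kkt_downdate_eq`). -/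
theorem kkt_update_eq (H : Matrix ν ν 𝕜) (Q : Matrix μ ν 𝕜) (E : Matrix κ ν 𝕜) :
    kkt (H + Eᵀ * E) Q = kkt H Q + (fromCols E (0 : Matrix κ μ 𝕜))ᵀ * fromCols E (0 : Matrix κ μ 𝕜) := by
  rw [transpose_fromCols, fromRows_mul_fromCols, kkt_eq_fromBlocks, kkt_eq_fromBlocks]
  ext (i | i) (j | j) <;> simp [fromBlocks]

/-- [folklore] **THE BORDERED DETERMINANT OF THE UPDATED FORM**: if `kkt H Q` is invertible, then
`det kkt (H + EᵀE) Q = det kkt H Q · det (1 + E·flucCov H Q·Eᵀ)`. -/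
theorem det_kkt_update (H : Matrix ν ν 𝕜) (Q : Matrix μ ν 𝕜) (E : Matrix κ ν 𝕜) (h : IsUnit (kkt H Q).det) :
    (kkt (H + Eᵀ * E) Q).det = (kkt H Q).det * (1 + E * flucCov H Q * Eᵀ).det := by
  rw [kkt_update_eq, det_update _ _ h, lift_mul_kktInv_mul_lift_transpose]

/-- [folklore] Hence invertibility of the updated bordered matrix is EQUIVALENT to that of `1 + E·flucCov H Q·Eᵀ` (given `kkt H Q` invertible). -/
theorem isUnit_det_kkt_update_iff (H : Matrix ν ν 𝕜) (Q : Matrix μ ν 𝕜) (E : Matrix κ ν 𝕜) (h : IsUnit (kkt H Q).det) :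
    IsUnit (kkt (H + Eᵀ * E) Q).det ↔ IsUnit (1 + E * flucCov H Q * Eᵀ).det := by
  rw [det_kkt_update H Q E h, IsUnit.mul_iff]
  exact ⟨fun hh => hh.2, fun hM => ⟨h, hM⟩⟩

/-! ## §3 With `H` invertible: the three factors -/

/-- [folklore] **THE THREE-FACTOR DECOMPOSITION, UPDATE SIGN**: for invertible `H` with `kkt H Q` invertible,
`det kkt (H + EᵀE) Q = (−1)^{|μ|} · (det H · det (Q H⁻¹ Qᵀ)) · det (1 + E·flucCov H Q·Eᵀ)`. -/
theorem det_kkt_update_three (H : Matrix ν ν 𝕜) (Q : Matrix μ ν 𝕜) (E : Matrix κ ν 𝕜) (hH : IsUnit H.det)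
    (h : IsUnit (kkt H Q).det) :
    (kkt (H + Eᵀ * E) Q).det
      = (-1) ^ Fintype.card μ * (H.det * (blockProp H Q).det) * (1 + E * flucCov H Q * Eᵀ).det := by
  rw [det_kkt_update H Q E h, det_kkt' H Q hH]

/-- [folklore] Absolute values: `|det kkt (H + EᵀE) Q| = |det H| · |det (QH⁻¹Qᵀ)| · |det (1 + EΓ₀Eᵀ)|`. -/
theorem abs_det_kkt_update_three (H : Matrix ν ν ℝ) (Q : Matrix μ ν ℝ) (E : Matrix κ ν ℝ) (hH : IsUnit H.det)
    (h : IsUnit (kkt H Q).det) :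
    |(kkt (H + Eᵀ * E) Q).det| = |H.det| * |(blockProp H Q).det| * |(1 + E * flucCov H Q * Eᵀ).det| := by
  rw [det_kkt_update_three H Q E hH h, abs_mul, abs_mul, abs_mul, abs_pow, abs_neg, abs_one, one_pow, one_mul]

/-! ## §4 Logarithmic (`logZ`) forms over `ℝ` -/

/-- [folklore] **THE ONE-LOOP FUNCTIONAL OF THE UPDATED SYSTEM**: `logZ (H + EᵀE) Q = logZ H Q − ½·log|det(1 + E·flucCov H Q·Eᵀ)|`. -/
theorem logZ_update (H : Matrix ν ν ℝ) (Q : Matrix μ ν ℝ) (E : Matrix κ ν ℝ) (h : IsUnit (kkt H Q).det)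
    (hM : IsUnit (1 + E * flucCov H Q * Eᵀ).det) :
    logZ (H + Eᵀ * E) Q = logZ H Q - (1 / 2 : ℝ) * Real.log |(1 + E * flucCov H Q * Eᵀ).det| := by
  unfold logZ
  rw [det_kkt_update H Q E h, abs_mul, Real.log_mul (abs_ne_zero.mpr h.ne_zero) (abs_ne_zero.mpr hM.ne_zero)]
  ring

/-- [folklore] **THE THREE-TERM FORM, UPDATE SIGN**: for invertible `H`,
`logZ (H + EᵀE) Q = ((|ν| − |μ|)/2)·log 2π − ½ log|det H| − ½ log|det(QH⁻¹Qᵀ)| − ½ log|det(1 + EΓ₀Eᵀ)|`. -/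
theorem logZ_update_three (H : Matrix ν ν ℝ) (Q : Matrix μ ν ℝ) (E : Matrix κ ν ℝ) (hH : IsUnit H.det)
    (h : IsUnit (kkt H Q).det) (hM : IsUnit (1 + E * flucCov H Q * Eᵀ).det) :
    logZ (H + Eᵀ * E) Q
      = ((Fintype.card ν : ℝ) - Fintype.card μ) / 2 * Real.log (2 * Real.pi)
        - (1 / 2 : ℝ) * Real.log |H.det| - (1 / 2 : ℝ) * Real.log |(blockProp H Q).det|
        - (1 / 2 : ℝ) * Real.log |(1 + E * flucCov H Q * Eᵀ).det| := by
  have hP : IsUnit (blockProp H Q).det := by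
    have hk := det_kkt' H Q hH
    have hne : (kkt H Q).det ≠ 0 := h.ne_zero
    rw [hk] at hne
    rw [isUnit_iff_ne_zero]
    intro hz
    apply hne
    rw [hz, mul_zero, mul_zero]
  unfold logZ
  rw [abs_det_kkt_update_three H Q E hH h,
    Real.log_mul (mul_ne_zero (abs_ne_zero.mpr hH.ne_zero) (abs_ne_zero.mpr hP.ne_zero)) (abs_ne_zero.mpr hM.ne_zero),
    Real.log_mul (abs_ne_zero.mpr hH.ne_zero) (abs_ne_zero.mpr hP.ne_zero)]
  ring

/-! ## §5 Two stages -/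

/-- [folklore] **TWO DOWNDATES** (R-FP-17 (H′2): first the constraint-type deficit `E₁`, then the ghost-type deficit `E₂`; the covariance
side is g8's `ConstrainedWoodbury.flucCov_downdate_twice`): with `Γ₀ := flucCov H Q`, `M₁ := 1 − E₁Γ₀E₁ᵀ`, `Γ₁ := flucCov (H − E₁ᵀE₁) Q`,
`M₂ := 1 − E₂Γ₁E₂ᵀ` all invertible where stated, `logZ (H − E₁ᵀE₁ − E₂ᵀE₂) Q = logZ H Q − ½ log|det M₁| − ½ log|det M₂|`. -/
theorem logZ_downdate_twice {κ' : Type*} [Fintype κ'] [DecidableEq κ'] (H : Matrix ν ν ℝ) (Q : Matrix μ ν ℝ)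
    (E₁ : Matrix κ ν ℝ) (E₂ : Matrix κ' ν ℝ) (h : IsUnit (kkt H Q).det) (hM₁ : IsUnit (1 - E₁ * flucCov H Q * E₁ᵀ).det)
    (hM₂ : IsUnit (1 - E₂ * flucCov (H - E₁ᵀ * E₁) Q * E₂ᵀ).det) :
    logZ (H - E₁ᵀ * E₁ - E₂ᵀ * E₂) Q
      = logZ H Q - (1 / 2 : ℝ) * Real.log |(1 - E₁ * flucCov H Q * E₁ᵀ).det|
        - (1 / 2 : ℝ) * Real.log |(1 - E₂ * flucCov (H - E₁ᵀ * E₁) Q * E₂ᵀ).det| := by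
  have h₁ : IsUnit (kkt (H - E₁ᵀ * E₁) Q).det := isUnit_det_kkt_downdate H Q E₁ h hM₁
  rw [logZ_downdate _ Q E₂ h₁ hM₂, logZ_downdate H Q E₁ h hM₁]

/-- [folklore] **A WEIGHT ADDED, THEN A DEFICIT REMOVED**: with `Γ₀ := flucCov H Q`, `M₊ := 1 + E₁Γ₀E₁ᵀ`, `Γ₊ := flucCov (H + E₁ᵀE₁) Q`,
`M₂ := 1 − E₂Γ₊E₂ᵀ`: `logZ (H + E₁ᵀE₁ − E₂ᵀE₂) Q = logZ H Q − ½ log|det M₊| − ½ log|det M₂|`. -/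
theorem logZ_update_downdate {κ' : Type*} [Fintype κ'] [DecidableEq κ'] (H : Matrix ν ν ℝ) (Q : Matrix μ ν ℝ)
    (E₁ : Matrix κ ν ℝ) (E₂ : Matrix κ' ν ℝ) (h : IsUnit (kkt H Q).det) (hM₁ : IsUnit (1 + E₁ * flucCov H Q * E₁ᵀ).det)
    (hM₂ : IsUnit (1 - E₂ * flucCov (H + E₁ᵀ * E₁) Q * E₂ᵀ).det) :
    logZ (H + E₁ᵀ * E₁ - E₂ᵀ * E₂) Q
      = logZ H Q - (1 / 2 : ℝ) * Real.log |(1 + E₁ * flucCov H Q * E₁ᵀ).det|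
        - (1 / 2 : ℝ) * Real.log |(1 - E₂ * flucCov (H + E₁ᵀ * E₁) Q * E₂ᵀ).det| := by
  have h₁ : IsUnit (kkt (H + E₁ᵀ * E₁) Q).det := (flucCov_update H Q E₁ h hM₁).1
  rw [logZ_downdate _ Q E₂ h₁ hM₂, logZ_update H Q E₁ h hM₁]

end Summit.QuantumFields.BalabanUV.Beta.FP.ReGaugedShotDeterminantUpdate
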